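import Summits.BirchSwinnertonDyer.Rank1Residual.X11b.LocalTorsionMultiplicative
import Summits.BirchSwinnertonDyer.Rank1Residual.X11b.BDPRouteTamagawaSupport
import Summits.BirchSwinnertonDyer.Rank1Residual.X11b.RouteLoci
import HarnessLib

/-!
# `E(ℚ_p)[p] ≠ 0` at a multiplicative prime forces `p ∣ c_p` (hypothesis (iv) of Castella's erratum is automatic off the Tamagawa atom)

HONEST FRAMING (cell `b2b-bsdres`, run/shared/lean/b2b/bsd-rank1-residual/, verbatim in every
file): the goal of the cell is to DELETE the COMBINATION-SHAPED residual classes of the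
Birch–Swinnerton-Dyer formula for ALL analytic-rank `≤ 1` elliptic curves over `ℚ` — "full BSD
formula for every rank `≤ 1` curve in class `C`" assembled STRICTLY from published theorems — so
that the rank-`≤ 1` remainder becomes exactly the CONSTRUCTION-SHAPED classes, which are TYPED
(missing-input `Prop`s), NOT attempted. This is not "finishing BSD". Sub-cell
`b2b-bsdres-multr1-p1` (X11b, route R1); no claim beyond the stated class; X11b stays
CONSTRUCTION-SHAPED; nothing here changes a label; no named fact (theorems only; no `sorry`).

## What this file kernel-checks, and why

`LocalTorsionMultiplicative.lean` (gen 6) proves hypothesis (iv) "`E(ℚ_p)[p] = 0`" of the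
erratum's Thm. 1.1 / Thm. A′ at a multiplicative prime `p ≥ 3` that is non-split or has
`p ∤ v_p(Δ_min)`. The cell's hypotheses seat (hyp GEN 15, `X11B-LOCAL.md`, engines H = K on all
`4 568 942` rank-`≤ 1` pairs `N < 5·10⁵` × odd `p ∥ N`) observed that **(iv) never fails without
`p ∣ c_p`** and asked for the kernel lemma. It is the contrapositive of gen 6 read through
Kodaira–Néron (`c_p = v_p(Δ_min)` at a split multiplicative prime, Silverman *ATAEC* IV.9.2,
tree `localTamagawaNumber_eq_padicValInt_of_split`): a non-zero `ℚ_p`-point killed by `p` forces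
the reduction to be SPLIT with `p ∣ v_p(Δ_min) = c_p`, hence `p ∣ ∏_ℓ c_ℓ(E)`.

* `localTorsion_eq_zero_of_not_dvd_localTamagawaNumber` — `p ≥ 3` multiplicative, `p ∤ c_p` ⟹
  `E(ℚ_p)[p] = 0`;
* `split_and_dvd_of_localTorsion_ne_zero` — `p ≥ 3` multiplicative, `P ∈ E(ℚ_p)`, `p • P = O`,
  `P ≠ O` ⟹ split at `p` ∧ `p ∣ v_p(Δ_min)` ∧ `p ∣ c_p` ∧ `p ∣ ∏_ℓ c_ℓ(E)` (hyp's observation);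
* `localTorsion_eq_zero_of_not_dvd_tamagawaProduct` — `p ≥ 3` multiplicative, `p ∤ ∏_ℓ c_ℓ(E)` ⟹
  `E(ℚ_p)[p] = 0`: **any display carrying `p ∤ ∏ c` (multr1-p2's `Locus`, the Kurihara / Kato
  lanes' `htors` binders on their `p ∤ Tam` rows) may drop (iv)**;
* `X11.aprimeLocusAt_of_not_dvd_tamagawaProduct`, `chainLocus_of_witnesses_of_not_dvd_tamagawaProduct`,
  `chainLocus_of_locus_of_witnesses` — the A′-locus / `ChainLocus` from the prime witnesses alone
  on `p ∤ ∏ c`; in particular on `Locus ∩ {Mult p, Irr p}` the local-torsion clause of route R1's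
  population is a theorem.

Effect (bookkeeping; labels unchanged; nothing booked): of the three census branches of (iv) —
non-split `p` / split with `p ∤ v_p(Δ)` / split with `p ∣ v_p(Δ)` — the first two are theorems
(gen 6) and the third is now located INSIDE the Tamagawa atom `p ∣ ∏ c` (= multr1-p2's (T2α),
`BDPRouteTamagawaSupport.lean`): off (T2) there is no local-torsion residue at all.

References: J. H. Silverman, *Advanced Topics in the Arithmetic of Elliptic Curves* (1994),
Cor. IV.9.2 [SilvermanATAEC1994]; *AEC* VII.2.1, VII.3.1, VII.6.1 [SilvermanAEC2009];
[Castella2018Erratum] Thm. 1.1 (iv), Thm. A′ (2) and Remark; [SkinnerZhang2014] Thm. 1.1 (b).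
-/

noncomputable section

open scoped Classical

namespace Summit.BirchSwinnertonDyer.Rank1Residual.X11b.LocalTorsion

open WeierstrassCurve IsDedekindDomain NumberField Rat.HeightOneSpectrum
  Literature.NumberTheory.EllipticCurves Literature.NumberTheory.EllipticCurves.Rank1Residual
  Literature.NumberTheory.EllipticCurves.Rank1Residual.Typed

variable (W : WeierstrassCurve ℚ) [W.IsElliptic] [W.IsGloballyMinimal] (p : ℕ) [hp : Fact p.Prime]

/-! ### `p ∤ c_p` ⟹ (iv) -/

/-- **`p ∤ c_p` ⟹ `E(ℚ_p)[p] = 0` at a multiplicative `p ≥ 3`.** If the reduction is split then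
`c_p = v_p(Δ_min)` (Kodaira–Néron, `localTamagawaNumber_eq_padicValInt_of_split`), so `p ∤ c_p`
is `p ∤ v_p(Δ_min)`; otherwise the reduction is non-split; either way
`localTorsion_eq_zero_of_mult` applies. [cite: SilvermanATAEC1994, Cor. IV.9.2(d) with (b) (PDF p. 340)]
[cite: Castella2018Erratum, Thm. 1.1 (iv), Thm. A′ (2) and Remark (pp. 1–2)] -/
theorem localTorsion_eq_zero_of_not_dvd_localTamagawaNumber (hp3 : 3 ≤ p) (hmult : Mult W p)
    (hc : ¬ p ∣ (W.baseChange ℚ_[p]).localTamagawaNumber ℤ_[p]) :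
    ∀ P : (W.baseChange ℚ_[p]).toAffine.Point, p • P = 0 → P = 0 := by
  refine fun P hP ↦ localTorsion_eq_zero_of_mult W p hp3 hmult ?_ P hP
  by_cases hs : W.HasSplitMultiplicativeReductionAtPrime p
  · right
    obtain ⟨v, hv⟩ : ∃ v : HeightOneSpectrum ℤ, (primesEquiv v : ℕ) = p :=
      ⟨primesEquiv.symm ⟨p, hp.out⟩, by rw [Equiv.apply_symm_apply]⟩
    rwa [localTamagawaNumber_eq_padicValInt_of_split W v hv hs] at hc
  · exact Or.inl hs

/-- **A non-zero `p`-torsion point of `E(ℚ_p)` at a multiplicative `p ≥ 3` forces: split reduction,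
`p ∣ v_p(Δ_min)`, `p ∣ c_p`, and `p ∣ ∏_ℓ c_ℓ(E)`** (the hypotheses seat's observation "(iv)
never fails without `p ∣ c_p`", X11B-LOCAL.md, on `4 568 942` pairs). Contrapositive of
`localTorsion_eq_zero_of_mult` + Kodaira–Néron. [cite: SilvermanATAEC1994, Cor. IV.9.2(d) with (b) (PDF p. 340)]
[cite: SilvermanAEC2009, Thm VII.6.1] -/
theorem split_and_dvd_of_localTorsion_ne_zero (hp3 : 3 ≤ p) (hmult : Mult W p)
    (P : (W.baseChange ℚ_[p]).toAffine.Point) (hP : p • P = 0) (hne : P ≠ 0) :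
    W.HasSplitMultiplicativeReductionAtPrime p ∧ p ∣ padicValInt p W.minimalDiscriminantInt ∧
      p ∣ (W.baseChange ℚ_[p]).localTamagawaNumber ℤ_[p] ∧ p ∣ W.tamagawaProduct := by
  -- split and `p ∣ v_p(Δ_min)`: otherwise gen 6 kills `P`
  have hs : W.HasSplitMultiplicativeReductionAtPrime p := by
    by_contra hns
    exact hne (localTorsion_eq_zero_of_mult W p hp3 hmult (Or.inl hns) P hP)
  have hv : p ∣ padicValInt p W.minimalDiscriminantInt := by
    by_contra hnv
    exact hne (localTorsion_eq_zero_of_mult W p hp3 hmult (Or.inr hnv) P hP)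
  refine ⟨hs, hv, ?_, dvd_tamagawaProduct_of_split_of_dvd W hs hv⟩
  obtain ⟨v, hpv⟩ : ∃ v : HeightOneSpectrum ℤ, (primesEquiv v : ℕ) = p :=
    ⟨primesEquiv.symm ⟨p, hp.out⟩, by rw [Equiv.apply_symm_apply]⟩
  rwa [localTamagawaNumber_eq_padicValInt_of_split W v hpv hs]

/-- **`p ∤ ∏_ℓ c_ℓ(E)` ⟹ `E(ℚ_p)[p] = 0` at a multiplicative `p ≥ 3`** (`c_p ∣ ∏ c`; any display
carrying `p ∤ ∏ c` may drop hypothesis (iv)). [cite: SilvermanATAEC1994, Cor. IV.9.2(d) with (b) (PDF p. 340)]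
[cite: Castella2018Erratum, Thm. 1.1 (iv), Thm. A′ (2) and Remark (pp. 1–2)] -/
theorem localTorsion_eq_zero_of_not_dvd_tamagawaProduct (hp3 : 3 ≤ p) (hmult : Mult W p)
    (htam : ¬ p ∣ W.tamagawaProduct) :
    ∀ P : (W.baseChange ℚ_[p]).toAffine.Point, p • P = 0 → P = 0 := by
  intro P hP
  by_contra hne
  exact htam (split_and_dvd_of_localTorsion_ne_zero W p hp3 hmult P hP hne).2.2.2

/-- The `ℤ`-scalar spelling: `p ∤ ∏_ℓ c_ℓ(E)`, `(p : ℤ) • P = 0` ⟹ `P = 0` (the shape of the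
`htors` binders of the Kurihara / Kato lanes). [cite: SilvermanAEC2009, VII.3 Prop. 3.1] -/
theorem localTorsion_eq_zero_of_not_dvd_tamagawaProduct_int (hp3 : 3 ≤ p) (hmult : Mult W p)
    (htam : ¬ p ∣ W.tamagawaProduct)
    (P : (W.baseChange ℚ_[p]).toAffine.Point) (hP : (p : ℤ) • P = 0) : P = 0 :=
  localTorsion_eq_zero_of_not_dvd_tamagawaProduct W p hp3 hmult htam P
    (by rw [← natCast_zsmul]; exact hP)

/-! ### The loci with the local-torsion clause discharged on `p ∤ ∏ c` -/

/-- **The A′-locus from its `q`-witness alone on `p ∤ ∏ c`.** For `W/ℚ` globally minimal elliptic,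
`p ≥ 3` multiplicative with `p ∤ ∏_ℓ c_ℓ(E)`, and a prime `q ≠ p` of non-split multiplicative
reduction with `p ∤ v_q(Δ_min)`: `X11.AprimeLocusAt W p`.
[cite: Castella2018Erratum, Thm. A′ (p. 1), hypotheses] -/
theorem X11.aprimeLocusAt_of_not_dvd_tamagawaProduct (hp3 : 3 ≤ p) (hmult : Mult W p)
    (htam : ¬ p ∣ W.tamagawaProduct)
    {q : ℕ} [Fact q.Prime] (hqp : q ≠ p) (hmq : Mult W q)
    (hnsq : ¬ W.HasSplitMultiplicativeReductionAtPrime q)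
    (hvq : ¬ p ∣ padicValInt q W.minimalDiscriminantInt) : X11.AprimeLocusAt W p :=
  ⟨⟨q, ‹_›, hqp, hmq, hnsq, hvq⟩, localTorsion_eq_zero_of_not_dvd_tamagawaProduct W p hp3 hmult htam⟩

/-- **Route R1's population from its two prime witnesses alone on `p ∤ ∏ c`.** For `p ≥ 5`
multiplicative with `E[p]` irreducible and `p ∤ ∏_ℓ c_ℓ(E)`, a non-split multiplicative `q ≠ p`
with `p ∤ v_q(Δ_min)` and a multiplicative `ℓ ∉ {p, q}` with `p ∤ v_ℓ(Δ_min)`: `ChainLocus W p`.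
[cite: Castella2018Erratum, Thm. A′ (p. 1), hypotheses] [cite: Castella2018, §5 (arXiv:1704.06608 p. 12), last step] -/
theorem chainLocus_of_witnesses_of_not_dvd_tamagawaProduct (hp5 : 5 ≤ p) (hmult : Mult W p)
    (hirr : Irr W p) (htam : ¬ p ∣ W.tamagawaProduct)
    {q : ℕ} [Fact q.Prime] {ℓ : ℕ} [Fact ℓ.Prime] (hqp : q ≠ p) (hℓp : ℓ ≠ p) (hℓq : ℓ ≠ q)
    (hmq : Mult W q) (hnsq : ¬ W.HasSplitMultiplicativeReductionAtPrime q)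
    (hvq : ¬ p ∣ padicValInt q W.minimalDiscriminantInt)
    (hmℓ : Mult W ℓ) (hvℓ : ¬ p ∣ padicValInt ℓ W.minimalDiscriminantInt) : ChainLocus W p :=
  ⟨hp5, hmult, hirr, ⟨q, ‹_›, ℓ, ‹_›, hqp, hℓp, hℓq, hmq, hnsq, hvq, hmℓ, hvℓ⟩,
    localTorsion_eq_zero_of_not_dvd_tamagawaProduct W p (by omega) hmult htam⟩

/-- **On multr1-p2's `Locus` (`5 ≤ p ∧ Ram ∧ p ∤ ∏ c`) the local-torsion clause of route R1 is a
theorem**: `Locus W p`, multiplicative at `p`, `E[p]` irreducible, a non-split multiplicative `q ≠ p`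
with `p ∤ v_q(Δ_min)` and a multiplicative `ℓ ∉ {p, q}` with `p ∤ v_ℓ(Δ_min)` ⟹ `ChainLocus W p`.
(The two populations then meet: `ChainLocus.locus_of_not_dvd_tamagawaProduct`.) [folklore] -/
theorem chainLocus_of_locus_of_witnesses (hL : Locus W p) (hmult : Mult W p) (hirr : Irr W p)
    {q : ℕ} [Fact q.Prime] {ℓ : ℕ} [Fact ℓ.Prime] (hqp : q ≠ p) (hℓp : ℓ ≠ p) (hℓq : ℓ ≠ q)
    (hmq : Mult W q) (hnsq : ¬ W.HasSplitMultiplicativeReductionAtPrime q)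
    (hvq : ¬ p ∣ padicValInt q W.minimalDiscriminantInt)
    (hmℓ : Mult W ℓ) (hvℓ : ¬ p ∣ padicValInt ℓ W.minimalDiscriminantInt) : ChainLocus W p :=
  chainLocus_of_witnesses_of_not_dvd_tamagawaProduct W p hL.1 hmult hirr hL.2.2 hqp hℓp hℓq hmq hnsq
    hvq hmℓ hvℓ

end Summit.BirchSwinnertonDyer.Rank1Residual.X11b.LocalTorsion

end
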